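import Summits.QuantumFields.YangMills.Theorems.UnitScaleGibbsLinProxySU2Letters
import HarnessLib

/-!
# `GrossTransferPauliReadField` — THE PAULI READING FUNCTIONAL `X ↦ Re tr((I•σ_α)·X)` AS A CONTINUOUS LINEAR MAP (norm ≤ 4) AND THE READ-OUT OF AN
# INVERSE: `Re tr(τ(W⁻¹ − 1)) = −Re tr(τ(W − 1))` (KNIT-E3 letters of the `stub_linTest` v3.2 package; LINE 28 «GrossTransfer», 23083∕19936)

Cell `ym3-torus` (YM ladder rung R3 — NOT d = 4, NOT infinite volume, NOT a mass gap, NOT Clay), width seat `ym-ust-19936-w2` (gen 15), pen of record.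
KNIT-PLAN v3 (23083 evidence #19), row P6: the dressed Bianchi bound ✓`UnitScaleGibbsChartPullbackBianchi.abs_dTwo_read_le_on_box` reads a plaquette field through
a continuous linear functional `λ`; the package reads with the three Pauli functionals `λ_α X = Re tr((I•σ_α)X)` and needs (i) `λ_α` AS a `→L[ℝ]` with an explicit
operator-norm bound (`≤ 4`, L2-operator norm on `M₂(ℂ)`), (ii) the antisymmetry of the read-out under orientation reversal, i.e. for `W ∈ SU(2)`:
`Re tr((I•σ_α)(↑W⁻¹ − 1)) = −Re tr((I•σ_α)(↑W − 1))` (since `W⁻¹ = W*` and `τ* = −τ`).  Scope: `Matrix.Norms.L2Operator` ONLY (see KNIT-PLAN v3's norm-scope pitfall).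
HONEST FRAMING.  Linear algebra on `M₂(ℂ)`; `--supports` helper; proves no stub, crux, rung or summit statement; the Yang–Mills mass gap is NOT proved.
References: [Balaban1985Averaging] (19)–(20) p.21; [GrossCMP1983] Thm 2.2.
-/

noncomputable section

open scoped BigOperators Matrix Matrix.Norms.L2Operator ComplexConjugate
open Complex
open Literature.MathematicalPhysics.QuantumFieldTheory.Balaban1983to89
open Literature.MathematicalPhysics.QuantumFieldTheory.Balaban1983to89.B10Eq18SigmaSU2 (pauli)
open Summit.QuantumFields.YangMills.Theorems.UnitScaleGibbsLinProxySU2Letters (abs_re_trace_le_two_mul_norm norm_I_smul_pauli_le_two conjTranspose_I_smul_pauli)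

namespace Summit.QuantumFields.YangMills.Theorems.GrossTransferPauliReadField

/-- ★ **THE PAULI READING FUNCTIONAL AS A CLM**: there is `λ_α : M₂(ℂ) →L[ℝ] ℝ` with `λ_α X = Re tr((I•σ_α)·X)` and `‖λ_α‖ ≤ 4`. [cite: Balaban1985Averaging, (19)-(20) p.21] -/
theorem exists_pauliRead (α : Fin 3) :
    ∃ lam : Matrix (Fin 2) (Fin 2) ℂ →L[ℝ] ℝ, (∀ X, lam X = ((I • pauli α) * X).trace.re) ∧ ‖lam‖ ≤ 4 := by
  -- the underlying ℝ-linear map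
  let L : Matrix (Fin 2) (Fin 2) ℂ →ₗ[ℝ] ℝ :=
    { toFun := fun X => ((I • pauli α) * X).trace.re
      map_add' := fun X Y => by rw [Matrix.mul_add, Matrix.trace_add, Complex.add_re]
      map_smul' := fun c X => by
        rw [Matrix.mul_smul, Matrix.trace_smul, RingHom.id_apply, Complex.real_smul, Complex.re_ofReal_mul, smul_eq_mul] }
  have hbound : ∀ X, ‖L X‖ ≤ 4 * ‖X‖ := fun X => by
    show |((I • pauli α) * X).trace.re| ≤ 4 * ‖X‖
    calc |((I • pauli α) * X).trace.re| ≤ 2 * ‖(I • pauli α) * X‖ := abs_re_trace_le_two_mul_norm _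
      _ ≤ 2 * (‖I • pauli α‖ * ‖X‖) := by gcongr; exact norm_mul_le _ _
      _ ≤ 2 * (2 * ‖X‖) := by gcongr; exact norm_I_smul_pauli_le_two α
      _ = 4 * ‖X‖ := by ring
  refine ⟨L.mkContinuous 4 hbound, fun X => rfl, ?_⟩
  exact LinearMap.mkContinuous_norm_le _ (by norm_num) _

/-- ★ **READ-OUT OF AN INVERSE**: for `W ∈ SU(2)` and the skew letter `τ = I•σ_α`, `Re tr(τ(↑W⁻¹ − 1)) = −Re tr(τ(↑W − 1))`. [cite: Balaban1985Averaging, (19)-(20) p.21] -/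
theorem re_trace_pauli_mul_inv_sub_one (α : Fin 3) (W : Matrix.specialUnitaryGroup (Fin 2) ℂ) :
    ((I • pauli α) * ((((W⁻¹ : Matrix.specialUnitaryGroup (Fin 2) ℂ)) : Matrix (Fin 2) (Fin 2) ℂ) - 1)).trace.re =
      -((I • pauli α) * ((W : Matrix (Fin 2) (Fin 2) ℂ) - 1)).trace.re := by
  have hinv : (((W⁻¹ : Matrix.specialUnitaryGroup (Fin 2) ℂ)) : Matrix (Fin 2) (Fin 2) ℂ) = star (W : Matrix (Fin 2) (Fin 2) ℂ) :=
    congrArg Subtype.val (Matrix.star_eq_inv W).symm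
  rw [hinv]
  have hτ : (I • pauli α)ᴴ = -(I • pauli α) := conjTranspose_I_smul_pauli α
  -- `τ·(W* − 1) = −((W − 1)·τ)ᴴ`, and `Re tr(Aᴴ) = Re tr A`, `tr((W−1)τ) = tr(τ(W−1))`
  have key : (I • pauli α) * (star (W : Matrix (Fin 2) (Fin 2) ℂ) - 1) = -(((W : Matrix (Fin 2) (Fin 2) ℂ) - 1) * (I • pauli α))ᴴ := by
    rw [Matrix.conjTranspose_mul, hτ, Matrix.conjTranspose_sub, Matrix.conjTranspose_one, ← Matrix.star_eq_conjTranspose, neg_mul, neg_neg]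
  rw [key, Matrix.trace_neg, Complex.neg_re, Matrix.trace_conjTranspose, Complex.star_def, Complex.conj_re, Matrix.trace_mul_comm]

end Summit.QuantumFields.YangMills.Theorems.GrossTransferPauliReadField

end
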